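import Literature.NumberTheory.Automorphic.UnitaryGroupDualPairReindex
import HarnessLib

/-!
# Place components of the finite-adelic pair embedding `U(J_V)(𝔸_{F,f}) × U(J_W)(𝔸_{F,f}) →* U(J_{VW})(𝔸_{F,f})`

Topic `NumberTheory/Automorphic`; namespace `Literature.NumberTheory.Automorphic.UnitaryGroup` (sequel of
`UnitaryGroupDualPairReindex.lean`: `finPairEmb`, and `UnitaryGroupRestrictedProduct.lean`: `finAdelicEquiv`,
`evalPlace`, `localInt`).  KERNEL ONLY: theorems; no definition, no named fact, no `sorry`.

[GelbartRogawski1991, §3.2 p. 457] embeds the unitary dual pair in `G₁ = U(V ⊗ W)` by `(k, u) ↦ k ⊗ u`; the tree's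
`finPairEmb … e J_V J_W` is this map on finite-adelic points in a `Fin n`-enumeration `e : Fin N × Fin M ≃ Fin n`.  Over the
finite adeles everything is PLACE BY PLACE ([PlatonovRapinchuk1994, §5.1]: `G(𝔸_f) = ∏'_v G(F_v)` functorially): this file
records

* `evalAt_finPairEmb` — the `w`-component of `k ⊗ u` is `k_w ⊗ u_w`: `(finPairEmb (k, u))_w = reindex e e (k_w ⊗ₖ u_w)`
  in `GL_n(E_w)`;
* `evalPlace_finPairEmb_congr` — hence the `v`-component `evalPlace v (finPairEmb (k, u)) ∈ U(J_{VW})(F_v)` depends only on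
  the `v`-components of `k` and `u` (LOCALITY), and
* `evalPlace_finPairEmb_mem_localInt` — lies in `U(J_{VW})(𝒪_v)` when `k_v ∈ U(J_V)(𝒪_v)` and `u_v ∈ U(J_W)(𝒪_v)`
  (INTEGRALITY: the entries of `k_w ⊗ u_w` and of its inverse `k_w⁻¹ ⊗ u_w⁻¹` are products of integers);
* `evalPlace_symm_mulSingle_self` ∕ `_of_ne` — the components of the local inclusion `ι_v = e⁻¹ ∘ mulSingle v`
  (`finAdelicEquiv`), and the two consequences the crux-H413 Euler factorisation consumes:
  `evalPlace_finPairEmb_eq_symm_mulSingle` (the `v`-component of `k ⊗ u` is that of `k ⊗ ι_v(u_v)`) and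
  `evalPlace_finPairEmb_symm_mulSingle_mem_localInt`.

## References
* [GelbartRogawski1991] S. Gelbart, J. Rogawski, Invent. Math. 105 (1991), §3.2 p. 457.
* [PlatonovRapinchuk1994] V. Platonov, A. Rapinchuk, *Algebraic Groups and Number Theory* (1994), §5.1.
-/

set_option autoImplicit false

noncomputable section

open scoped Matrix Kronecker RestrictedProduct
open NumberField IsDedekindDomain

namespace Literature.NumberTheory.Automorphic

namespace UnitaryGroup

variable (F E : Type) [Field F] [NumberField F] [Field E] [NumberField E] [Algebra F E]
variable (c : E ≃ₐ[F] E) (N M : ℕ) {n : ℕ} (e : Fin N × Fin M ≃ Fin n)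
variable (JV : Matrix (Fin N) (Fin N) E) (JW : Matrix (Fin M) (Fin M) E)

/-! ## §1 The `w`-component of `k ⊗ u` -/

omit [NumberField F] in
/-- **the `w`-component of `finPairEmb (k, u)` is `reindex e e (k_w ⊗ₖ u_w)`** (evaluation at a place is a ring
homomorphism, so it commutes with Kronecker products and re-indexing). [cite: GelbartRogawski1991, §3.2 p. 457] -/
theorem evalAt_finPairEmb (k : finAdelic F E c N JV) (u : finAdelic F E c M JW) (w : HeightOneSpectrum (𝓞 E)) :
    GLn.evalAt n E w ((finPairEmb F E c N M e JV JW (k, u) : finAdelic F E c n (Matrix.reindex e e (JV ⊗ₖ JW))) :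
        GL (Fin n) (FiniteAdeleRing (𝓞 E) E)) =
      reindexGL e (kroneckerGL (GLn.evalAt N E w (k : GL (Fin N) (FiniteAdeleRing (𝓞 E) E)),
        GLn.evalAt M E w (u : GL (Fin M) (FiniteAdeleRing (𝓞 E) E)))) := by
  refine Units.ext (Matrix.ext fun i j => ?_)
  rw [GLn.coe_evalAt_apply, coe_finPairEmb, coe_reindexGL, coe_reindexGL, coe_kroneckerGL, coe_kroneckerGL,
    Matrix.reindex_apply, Matrix.reindex_apply, Matrix.submatrix_apply, Matrix.submatrix_apply,
    Matrix.kroneckerMap_apply, Matrix.kroneckerMap_apply, GLn.coe_evalAt_apply, GLn.coe_evalAt_apply]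
  rfl

/-! ## §2 Locality and integrality of the `v`-component -/

/-- **LOCALITY: the `v`-component of `finPairEmb (k, u)` depends only on the `v`-components of `k` and `u`.**
[cite: PlatonovRapinchuk1994, §5.1] -/
theorem evalPlace_finPairEmb_congr {k k' : finAdelic F E c N JV} {u u' : finAdelic F E c M JW}
    (v : HeightOneSpectrum (𝓞 F)) (hk : evalPlace F E c N JV v k = evalPlace F E c N JV v k')
    (hu : evalPlace F E c M JW v u = evalPlace F E c M JW v u') :
    evalPlace F E c n (Matrix.reindex e e (JV ⊗ₖ JW)) v (finPairEmb F E c N M e JV JW (k, u)) =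
      evalPlace F E c n (Matrix.reindex e e (JV ⊗ₖ JW)) v (finPairEmb F E c N M e JV JW (k', u')) := by
  refine Subtype.ext (funext fun w => ?_)
  have hk' := congrArg (fun g : localPi E c N JV v => (g : LocalGLPi E N v) w) hk
  have hu' := congrArg (fun g : localPi E c M JW v => (g : LocalGLPi E M v) w) hu
  simp only [coe_evalPlace_apply] at hk' hu' ⊢
  rw [evalAt_finPairEmb, evalAt_finPairEmb, hk', hu']

/-- **INTEGRALITY: if `k_v ∈ U(J_V)(𝒪_v)` and `u_v ∈ U(J_W)(𝒪_v)` then `(finPairEmb (k, u))_v ∈ U(J_{VW})(𝒪_v)`** (the entries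
of `k_w ⊗ u_w` and of `(k_w ⊗ u_w)⁻¹ = k_w⁻¹ ⊗ u_w⁻¹` are products of `w`-integers, for every `w ∣ v`).
[cite: PlatonovRapinchuk1994, §5.1] -/
theorem evalPlace_finPairEmb_mem_localInt (k : finAdelic F E c N JV) (u : finAdelic F E c M JW)
    (v : HeightOneSpectrum (𝓞 F)) (hk : evalPlace F E c N JV v k ∈ localInt E c N JV v)
    (hu : evalPlace F E c M JW v u ∈ localInt E c M JW v) :
    evalPlace F E c n (Matrix.reindex e e (JV ⊗ₖ JW)) v (finPairEmb F E c N M e JV JW (k, u)) ∈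
      localInt E c n (Matrix.reindex e e (JV ⊗ₖ JW)) v := by
  rw [evalPlace_mem_localInt_iff] at hk hu ⊢
  intro w
  have h1 := (mem_glInt_iff _).1 (hk w)
  have h2 := (mem_glInt_iff _).1 (hu w)
  rw [evalAt_finPairEmb, mem_glInt_iff]
  refine ⟨fun i j => ?_, fun i j => ?_⟩
  · rw [coe_reindexGL, Matrix.reindex_apply, Matrix.submatrix_apply, coe_kroneckerGL, Matrix.kroneckerMap_apply]
    exact mul_mem (h1.1 _ _) (h2.1 _ _)
  · rw [← map_inv, ← map_inv, Prod.inv_mk, coe_reindexGL, Matrix.reindex_apply, Matrix.submatrix_apply,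
      coe_kroneckerGL, Matrix.kroneckerMap_apply]
    exact mul_mem (h1.2 _ _) (h2.2 _ _)

/-! ## §3 The local inclusions `ι_v = e⁻¹ ∘ mulSingle v` and the pair embedding -/

section Single

variable [DecidableEq (HeightOneSpectrum (𝓞 F))]

/-- the `v`-component of `ι_v(g) = finAdelicEquiv⁻¹ (mulSingle v g)` is `g`. [cite: PlatonovRapinchuk1994, §5.1] -/
theorem evalPlace_symm_mulSingle_self (v : HeightOneSpectrum (𝓞 F)) (g : localPi E c M JW v) :
    evalPlace F E c M JW v ((finAdelicEquiv F E c M JW).symm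
      (RestrictedProduct.mulSingle (fun v => localInt E c M JW v) v g)) = g := by
  change (finAdelicEquiv F E c M JW ((finAdelicEquiv F E c M JW).symm _)) v = g
  rw [ContinuousMulEquiv.apply_symm_apply]
  exact RestrictedProduct.mulSingle_eq_same (fun v => localInt E c M JW v) v g

/-- the `v'`-component of `ι_v(g)` is `1` for `v' ≠ v`. [cite: PlatonovRapinchuk1994, §5.1] -/
theorem evalPlace_symm_mulSingle_of_ne {v v' : HeightOneSpectrum (𝓞 F)} (h : v' ≠ v) (g : localPi E c M JW v) :
    evalPlace F E c M JW v' ((finAdelicEquiv F E c M JW).symm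
      (RestrictedProduct.mulSingle (fun v => localInt E c M JW v) v g)) = 1 := by
  change (finAdelicEquiv F E c M JW ((finAdelicEquiv F E c M JW).symm _)) v' = 1
  rw [ContinuousMulEquiv.apply_symm_apply]
  exact RestrictedProduct.mulSingle_eq_of_ne (fun v => localInt E c M JW v) g h

/-- **the `v`-component of `k ⊗ u` is that of `k ⊗ ι_v(u_v)`**: the local pair embedding at `v` read through the global one
(`u ↦ (finPairEmb (k, ι_v(u_v)))_v`). [cite: GelbartRogawski1991, §3.2 p. 457] [cite: PlatonovRapinchuk1994, §5.1] -/
theorem evalPlace_finPairEmb_eq_symm_mulSingle (k : finAdelic F E c N JV) (u : finAdelic F E c M JW)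
    (v : HeightOneSpectrum (𝓞 F)) :
    evalPlace F E c n (Matrix.reindex e e (JV ⊗ₖ JW)) v (finPairEmb F E c N M e JV JW (k, u)) =
      evalPlace F E c n (Matrix.reindex e e (JV ⊗ₖ JW)) v (finPairEmb F E c N M e JV JW
        (k, (finAdelicEquiv F E c M JW).symm
          (RestrictedProduct.mulSingle (fun v => localInt E c M JW v) v (evalPlace F E c M JW v u)))) :=
  evalPlace_finPairEmb_congr F E c N M e JV JW v rfl (evalPlace_symm_mulSingle_self F E c M JW v _).symm

/-- **`(finPairEmb (k, ι_v(g)))_v ∈ U(J_{VW})(𝒪_v)` for `k_v ∈ U(J_V)(𝒪_v)`, `g ∈ U(J_W)(𝒪_v)`.**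
[cite: PlatonovRapinchuk1994, §5.1] -/
theorem evalPlace_finPairEmb_symm_mulSingle_mem_localInt (k : finAdelic F E c N JV) (v : HeightOneSpectrum (𝓞 F))
    (hk : evalPlace F E c N JV v k ∈ localInt E c N JV v) (g : localPi E c M JW v) (hg : g ∈ localInt E c M JW v) :
    evalPlace F E c n (Matrix.reindex e e (JV ⊗ₖ JW)) v (finPairEmb F E c N M e JV JW
        (k, (finAdelicEquiv F E c M JW).symm (RestrictedProduct.mulSingle (fun v => localInt E c M JW v) v g))) ∈
      localInt E c n (Matrix.reindex e e (JV ⊗ₖ JW)) v :=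
  evalPlace_finPairEmb_mem_localInt F E c N M e JV JW k _ v hk
    (by rw [evalPlace_symm_mulSingle_self]; exact hg)

end Single

end UnitaryGroup

end Literature.NumberTheory.Automorphic

end
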